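import Literature.AlgebraicGeometry.Morphisms.SteinFactorization
import Mathlib.AlgebraicGeometry.FunctionField
import Mathlib.RingTheory.LocalProperties.IntegrallyClosed
import HarnessLib

/-!
# Proper morphisms towards a normal base (Stacks Project, Tag 0AY8) — proofs

Sibling proof file of `Literature/AlgebraicGeometry/Morphisms/SteinFactorization.lean` for the named
fact `Literature.AlgebraicGeometry.Morphisms.geometricallyConnected_towards_normal`, The Stacks
Project, Tag 0AY8 (More on Morphisms, Lemma 37.53.6), printed statement:

> Let `f : X → S` be a morphism of schemes. Assume (1) `f` is proper, (2) `S` is integral with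
> generic point `ξ`, (3) `S` is normal, (4) `X` is reduced, (5) every generic point of an
> irreducible component of `X` maps to `ξ`, (6) we have `H⁰(X_ξ, 𝒪) = κ(ξ)`. Then
> `f_* 𝒪_X = 𝒪_S` and `f` has geometrically connected fibres.

Printed proof: "Apply Theorem 37.53.5 [Tag 03H2, Stein factorisation `X → S' → S`] to get a
factorization `X → S' → S`. It is enough to show that `S' = S`. This will follow from Morphisms,
Lemma 29.55.8. Namely, `S'` is reduced because `X` is reduced (Morphisms, Lemma 29.54.8). The
morphism `S' → S` is integral by the theorem cited above. Every generic point of `S'` lies over `ξ`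
by Morphisms, Lemma 29.54.9 and assumption (5). On the other hand, since `S'` is the relative
spectrum of `f_*𝒪_X` we see that the scheme theoretic fibre `S'_ξ` is the spectrum of
`H⁰(X_ξ, 𝒪)` which is equal to `κ(ξ)` by assumption. Hence `S'` is an integral scheme with
function field equal to the function field of `S`. This finishes the proof."

This file formalises that proof, with one rearrangement forced by the library: Mathlib's relative
normalisation `f.normalization` (Tag 035H) is `Spec` of the integral closure of `𝒪_S` in
`f_* 𝒪_X`, and item (4) of Tag 03H2, `S' = Spec_S(f_* 𝒪_X)`, is not available, so the same four
ingredients (torsion-freeness of `f_* 𝒪_X` from (4)–(5), the generic fibre (6), integrality of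
`f_* 𝒪_X` over `𝒪_S` for `f` universally closed, normality of `S`) are combined directly into
`f_* 𝒪_X = 𝒪_S` on affine opens (as in Hartshorne, proof of III Cor. 11.4: "`A` and `B` are
integral domains with the same quotient field, and `A` is integrally closed, so we must have
`A = B`"), from which `S' = S` follows. Everything except the appeal to Tag 03H2 (1) is proved
unconditionally, for `f` universally closed (and quasi-separated where `S'` occurs):

* `TowardsNormal.bijective_app`, `TowardsNormal.isIso_app` — **`f_* 𝒪_X = 𝒪_S`**: for every open
  `U ⊆ S`, `𝒪_S(U) → 𝒪_X(f⁻¹U)` is an isomorphism. On a non-empty affine open `U`, with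
  `A = 𝒪_S(U)` (an integrally closed domain, `isIntegrallyClosed_sections_of_stalk`) and
  `B = 𝒪_X(f⁻¹U)`: the restriction `ρ : B → Γ(X_ξ, 𝒪)` to the fibre over the generic point is
  injective (`injective_appLE_fiberι_top`: a section killed by `ρ` is a non-unit at every generic
  point of `X`, all of which lie in the image of `X_ξ → X` by (5); generic points are dense, so its
  non-vanishing locus is empty and it is `0` as `X` is reduced — this is "torsion free");
  `Γ(Spec κ(ξ), 𝒪) ≅ κ(ξ) = Frac A` (`isFractionRing_sections_residueField_genericPoint`) maps
  isomorphically to `Γ(X_ξ, 𝒪)` by (6); `A → B` is integral (`f` universally closed, Mathlib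
  `isIntegral_appTop_of_universallyClosed`); so each `b ∈ B` restricts to an element of `Frac A`
  integral over `A`, i.e. to some `a ∈ A`, and `b = a`. General `U`: the affine opens form a basis
  (`isIso_app_of_isIso_app_of_isAffineOpen`, Mathlib `TopCat.Sheaf.isIso_iff_isIso_basis`).
* `TowardsNormal.isIso_fromNormalization` — **`S' = S`**: Mathlib's relative normalisation
  `f.fromNormalization : f.normalization → S` (Tag 035H) is an isomorphism, being affine-locally
  `Spec` of the integral closure of `𝒪_S(U)` in `𝒪_X(f⁻¹U) = 𝒪_S(U)`.
* `geometricallyConnected_towards_normal_of_steinFactorization` — Tag 0AY8 (the named fact, both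
  conclusions) from Tag 03H2 (1) (the named fact `steinFactorization_geometricallyConnected`:
  `f' = f.toNormalization` has geometrically connected fibres), through
  `steinFactorization_geometricallyConnected.of_isIso_fromNormalization`; and, for one morphism,
  `geometricallyConnected_towards_normal_of_toNormalization` (input: `GeometricallyConnected
  f.toNormalization` for this `f` only).

What remains for `geometricallyConnected_towards_normal_holds` is therefore exactly Zariski's
connectedness theorem in the form Tag 03H2 (1) (theorem on formal functions, Tag 02OC, and the
limit arguments of Tag 03H2 for a non-Noetherian base), which is not in Mathlib.

## References

* The Stacks Project, Tag 0AY8 (More on Morphisms, Lemma 37.53.6, statement and proof); Tag 03H2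
  (More on Morphisms, Theorem 37.53.5); Tag 035H (Morphisms, Definition 29.54.3: normalization of
  `S` in `X`); Tag 033H/033I (Properties, Section 28.7 and Definition 28.7.1: normal schemes);
  Tag 030B (Algebra, Lemma 10.37.10: normality of a domain is local); Tag 01WM (Morphisms,
  Lemma 29.45.7: integral = affine + universally closed).
* R. Hartshorne, *Algebraic Geometry*, GTM 52 (1977), III, Corollary 11.3 and the proof of
  Corollary 11.4 (p. 280).
* A. Grothendieck, EGA III₁, Théorème 4.3.1 and Corollaires 4.3.2–4.3.4 (Zariski's connectedness
  theorem).
-/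

noncomputable section

open CategoryTheory AlgebraicGeometry Opposite TopologicalSpace

universe u

namespace Literature.AlgebraicGeometry.Morphisms

namespace TowardsNormal

variable {X Y S : Scheme.{u}}

/-! ### Small pieces of sheaf calculus -/

/-- On sections over an open `U ∋ x`, the canonical morphism `Spec κ(x) → X` is: germ at `x`,
then the residue map `𝒪_{X,x} → κ(x)`, then `κ(x) ≅ Γ(Spec κ(x), 𝒪)`. [folklore] -/
theorem fromSpecResidueField_appLE_top (X : Scheme.{u}) (x : X) (U : X.Opens) (hxU : x ∈ U)
    (h : (⊤ : (Spec (X.residueField x)).Opens) ≤ (X.fromSpecResidueField x) ⁻¹ᵁ U) :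
    (X.fromSpecResidueField x).appLE U ⊤ h =
      X.presheaf.germ U x hxU ≫ X.residue x ≫ (Scheme.ΓSpecIso (X.residueField x)).inv := by
  have h' : (⊤ : (Spec (X.residueField x)).Opens) ≤
      (Spec.map (X.residue x)) ⁻¹ᵁ ((X.fromSpecStalk x) ⁻¹ᵁ U) := h
  have h1 : (X.fromSpecResidueField x).appLE U ⊤ h =
      (X.fromSpecStalk x).appLE U ((X.fromSpecStalk x) ⁻¹ᵁ U) le_rfl ≫
        (Spec.map (X.residue x)).appLE ((X.fromSpecStalk x) ⁻¹ᵁ U) ⊤ h' := by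
    rw [Scheme.Hom.appLE_comp_appLE]
    rfl
  rw [h1, ← Scheme.Hom.app_eq_appLE, Scheme.fromSpecStalk_app hxU]
  simp only [Category.assoc]
  congr 1
  rw [Scheme.Hom.map_appLE, Scheme.ΓSpecIso_inv_naturality]
  rfl

/-- A morphism of schemes `f : X → S` inducing isomorphisms `𝒪_S(U) → 𝒪_X(f⁻¹U)` for all *affine*
opens `U ⊆ S` induces isomorphisms for all opens `U` (`𝒪_S → f_* 𝒪_X` is a morphism of sheaves and
the affine opens form a basis; Mathlib `TopCat.Sheaf.isIso_iff_isIso_basis`). [folklore] -/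
theorem isIso_app_of_isIso_app_of_isAffineOpen (f : X ⟶ S)
    (h : ∀ U : S.Opens, IsAffineOpen U → IsIso (f.app U)) (U : S.Opens) : IsIso (f.app U) := by
  let φ : S.sheaf ⟶ (TopCat.Sheaf.pushforward _ f.base).obj X.sheaf := ⟨f.c⟩
  haveI : IsIso φ :=
    TopCat.Sheaf.isIso_iff_isIso_basis (B := fun U : S.affineOpens ↦ (U : S.Opens))
      (by rw [Subtype.range_coe]; exact S.isBasis_affineOpens) (fun U ↦ h U.1 U.2)
  haveI : IsIso ((TopCat.Sheaf.forget _ _).map φ) := inferInstance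
  exact NatIso.isIso_app_of_isIso ((TopCat.Sheaf.forget _ _).map φ) (op U)

/-- Sections over the empty open: `f.app ⊥` is an isomorphism (both sides are the zero ring).
[folklore] -/
theorem isIso_app_of_eq_bot (f : X ⟶ S) {U : S.Opens} (hU : U = ⊥) : IsIso (f.app U) := by
  have h1 : Subsingleton Γ(S, U) :=
    CommRingCat.subsingleton_of_isTerminal (S.sheaf.isTerminalOfEqEmpty hU)
  have h2 : Subsingleton Γ(X, f ⁻¹ᵁ U) :=
    CommRingCat.subsingleton_of_isTerminal (X.sheaf.isTerminalOfEqEmpty (by rw [hU]; rfl))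
  exact (ConcreteCategory.isIso_iff_bijective _).mpr
    ⟨fun a b _ ↦ Subsingleton.elim _ _, fun b ↦ ⟨0, Subsingleton.elim _ _⟩⟩

/-! ### The generic point and the fibre over it -/

section genericPoint

variable (S : Scheme.{u}) [IsIntegral S]

/-- The generic point of an integral scheme lies in every non-empty open. [folklore] -/
theorem genericPoint_mem (U : S.Opens) [h : Nonempty U] : genericPoint S ∈ U :=
  ((genericPoint_spec S).mem_open_set_iff U.isOpen).mpr (by simpa using h)

/-- `Spec κ(ξ) → S` lands in every non-empty open `U`. [folklore] -/
theorem top_le_preimage_fromSpecResidueField (U : S.Opens) [Nonempty U] :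
    (⊤ : (Spec (S.residueField (genericPoint S))).Opens) ≤
      (S.fromSpecResidueField (genericPoint S)) ⁻¹ᵁ U := by
  rintro p -
  show (S.fromSpecResidueField (genericPoint S)) p ∈ U
  rw [Scheme.fromSpecResidueField_apply]
  exact genericPoint_mem S U

/-- **`κ(ξ)` is the fraction field of `𝒪_S(U)`.** For an integral scheme `S` with generic point
`ξ` and a non-empty affine open `U`, `Γ(Spec κ(ξ), 𝒪)` with the algebra structure coming from
`Spec κ(ξ) → S` is a fraction field of `Γ(S, U)`: `𝒪_{S,ξ}` is the function field, a fraction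
field of `Γ(S, U)` (Mathlib `functionField_isFractionRing_of_isAffineOpen`), and it is a field, so
that `𝒪_{S,ξ} → κ(ξ)` is bijective. [folklore] -/
theorem isFractionRing_sections_residueField_genericPoint (U : S.Opens) (hU : IsAffineOpen U)
    [Nonempty U] :
    letI := ((S.fromSpecResidueField (genericPoint S)).appLE U ⊤
      (top_le_preimage_fromSpecResidueField S U)).hom.toAlgebra
    IsFractionRing Γ(S, U) Γ(Spec (S.residueField (genericPoint S)), ⊤) := by
  letI := ((S.fromSpecResidueField (genericPoint S)).appLE U ⊤
      (top_le_preimage_fromSpecResidueField S U)).hom.toAlgebra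
  haveI := functionField_isFractionRing_of_isAffineOpen S U hU
  -- the residue map at the generic point is bijective (`𝒪_{S,ξ}` is a field)
  have hres : Function.Bijective (S.residue (genericPoint S)).hom := by
    refine ⟨?_, S.residue_surjective _⟩
    rw [RingHom.injective_iff_ker_eq_bot]
    have hF : IsField (S.presheaf.stalk (genericPoint S)) := Field.toIsField S.functionField
    change RingHom.ker (IsLocalRing.residue _) = ⊥
    rw [IsLocalRing.ker_residue]
    exact (IsLocalRing.isField_iff_maximalIdeal_eq).mp hF
  let e₁ : S.functionField ≃+* S.residueField (genericPoint S) :=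
    RingEquiv.ofBijective (S.residue (genericPoint S)).hom hres
  let e₂ : S.residueField (genericPoint S) ≃+* Γ(Spec (S.residueField (genericPoint S)), ⊤) :=
    (Scheme.ΓSpecIso (S.residueField (genericPoint S))).symm.commRingCatIsoToRingEquiv
  let e : S.functionField ≃ₐ[Γ(S, U)] Γ(Spec (S.residueField (genericPoint S)), ⊤) :=
    AlgEquiv.ofRingEquiv (f := e₁.trans e₂) (fun a ↦ by
      change (Scheme.ΓSpecIso _).inv ((S.residue (genericPoint S)) (S.germToFunctionField U a)) =
        (S.fromSpecResidueField (genericPoint S)).appLE U ⊤ _ a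
      rw [fromSpecResidueField_appLE_top S (genericPoint S) U (genericPoint_mem S U)]
      rfl)
  exact IsLocalization.isLocalization_of_algEquiv _ e

end genericPoint

/-- **Restriction to the fibre over `ξ` is injective** when `X` is reduced and all generic points
of irreducible components of `X` lie over `ξ`: a section `b` of `𝒪_X` whose restriction to
`X_ξ` vanishes is not a unit in `𝒪_{X,η}` for any generic point `η` (the stalks of `X_ξ` are
non-zero local rings and `𝒪_{X,η} → 𝒪_{X_ξ,η'}` is a ring map), so the open `D(b)` contains no
generic point; generic points are dense, so `D(b) = ∅`, i.e. `b = 0` as `X` is reduced (Mathlib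
`basicOpen_eq_bot_iff`). (Stacks Project, Tag 0AY8, proof: "`f_* 𝒪_X` is torsion free".)
[cite: StacksProject, Tag 0AY8 (More on Morphisms, Lemma 37.53.6, proof)] -/
theorem injective_appLE_fiberι_top (f : X ⟶ S) [IsReduced X] {ξ : S}
    (hX : ∀ x ∈ genericPoints X, f.base x = ξ) (V : X.Opens)
    (hle : (⊤ : (f.fiber ξ).Opens) ≤ (f.fiberι ξ) ⁻¹ᵁ V) :
    Function.Injective ((f.fiberι ξ).appLE V ⊤ hle) := by
  rw [injective_iff_map_eq_zero]
  intro b hb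
  rw [← basicOpen_eq_bot_iff]
  by_contra hne
  have hne' : ((X.basicOpen b : X.Opens) : Set X).Nonempty := by
    rw [Set.nonempty_iff_ne_empty]
    exact fun h ↦ hne (Opens.coe_eq_empty.mp h)
  obtain ⟨x, hxb, hxg⟩ := (dense_iff_closure_eq.mpr genericPoints.closure).inter_open_nonempty _
    (X.basicOpen b).isOpen hne'
  have hxV : x ∈ V := X.basicOpen_le b hxb
  obtain ⟨x', rfl⟩ : x ∈ Set.range (f.fiberι ξ) := by
    rw [Scheme.Hom.range_fiberι]; exact hX x hxg
  have hunit : IsUnit (X.presheaf.germ V _ hxV b) := (X.mem_basicOpen b _ hxV).mp hxb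
  have h2 := hunit.map ((f.fiberι ξ).stalkMap x').hom
  rw [Scheme.Hom.germ_stalkMap_apply] at h2
  have h3 : (f.fiber ξ).presheaf.germ ((f.fiberι ξ) ⁻¹ᵁ V) x' hxV ((f.fiberι ξ).app V b) =
      (f.fiber ξ).presheaf.germ ⊤ x' trivial ((f.fiberι ξ).appLE V ⊤ hle b) := by
    rw [Scheme.Hom.appLE, CommRingCat.comp_apply, TopCat.Presheaf.germ_res_apply]
  rw [h3, hb, map_zero] at h2
  exact not_isUnit_zero h2

/-- For `f : X → S` universally closed and `U ⊆ S` affine open, `𝒪_S(U) → 𝒪_X(f⁻¹U)` is an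
integral ring map (Mathlib `isIntegral_appTop_of_universallyClosed`, applied to `f⁻¹U → U`; the
algebra behind Stacks Project, Tag 01WM: universally closed + affine = integral).
[cite: StacksProject, Tag 01WM (Morphisms, Lemma 29.45.7)] -/
theorem isIntegral_app_of_universallyClosed (f : X ⟶ S) [UniversallyClosed f] (U : S.Opens)
    (hU : IsAffineOpen U) : (f.app U).hom.IsIntegral := by
  haveI : IsAffine U := hU
  have h := isIntegral_appTop_of_universallyClosed (f ∣_ U)
  rw [morphismRestrict_appTop] at h
  have h' : (f.app (U.ι ''ᵁ ⊤)).hom.IsIntegral := by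
    set e := X.presheaf.map (eqToHom (show (f ⁻¹ᵁ U).ι ''ᵁ ⊤ = f ⁻¹ᵁ U.ι ''ᵁ ⊤ by
      rw [Scheme.Opens.ι_image_top, Scheme.Opens.ι_image_top])).op with he
    have h2 : (f.app (U.ι ''ᵁ ⊤) ≫ e ≫ inv e).hom.IsIntegral := by
      rw [← Category.assoc, CommRingCat.hom_comp]
      exact RingHom.IsIntegral.trans _ _ h (RingHom.isIntegral_of_surjective _
        (ConcreteCategory.bijective_of_isIso (inv e)).2)
    simpa using h2
  rwa [Scheme.Opens.ι_image_top] at h'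

/-- Normality from the stalks: if all local rings `𝒪_{X,x}` are integrally closed and `U` is an
affine open with `Γ(X, U)` a domain, then `Γ(X, U)` is integrally closed (its localisations at
maximal ideals are stalks; Mathlib `IsIntegrallyClosed.of_localization_maximal`; Stacks Project,
Tag 030B: a domain is normal iff its localisations at maximal ideals are).
[cite: StacksProject, Tag 033I (Properties, Definition 28.7.1) and Tag 030B (Algebra, Lemma 10.37.10)] -/
theorem isIntegrallyClosed_sections_of_stalk {U : X.Opens} (hU : IsAffineOpen U)
    [IsDomain Γ(X, U)] (h : ∀ x : X, IsIntegrallyClosed (X.presheaf.stalk x)) :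
    IsIntegrallyClosed Γ(X, U) := by
  letI (y : _) : Algebra Γ(X, U) (X.presheaf.stalk (hU.fromSpec y)) :=
    TopCat.Presheaf.algebra_section_stalk X.presheaf _
  refine IsIntegrallyClosed.of_localization_maximal (fun P _ hP ↦ ?_)
  haveI : IsLocalization.AtPrime (X.presheaf.stalk (hU.fromSpec ⟨P, hP.isPrime⟩)) P :=
    hU.isLocalization_stalk' ⟨P, hP.isPrime⟩ (hU.isoSpec.inv _).2
  haveI := h (hU.fromSpec ⟨P, hP.isPrime⟩)
  exact IsIntegrallyClosed.of_equiv (IsLocalization.algEquiv P.primeCompl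
    (X.presheaf.stalk (hU.fromSpec ⟨P, hP.isPrime⟩)) (Localization.AtPrime P)).toRingEquiv


/-! ### Tag 0AY8: `f_* 𝒪_X = 𝒪_S` and `S' = S` -/

section Main

variable (f : X ⟶ S) [UniversallyClosed f] [IsIntegral S]
  (hS : ∀ s : S, IsIntegrallyClosed (S.presheaf.stalk s)) [IsReduced X]
  (hX : ∀ x ∈ genericPoints X, f.base x = genericPoint S)
  (hξ : IsIso (f.fiberToSpecResidueField (genericPoint S)).appTop)
include hS hX hξ

/-- **Tag 0AY8, `f_* 𝒪_X = 𝒪_S` on a non-empty affine open.** Under the hypotheses of Stacks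
Project, Tag 0AY8 (with "proper" weakened to "universally closed"), `𝒪_S(U) → 𝒪_X(f⁻¹U)` is
bijective for every non-empty affine open `U ⊆ S`. Printed proof: `f_* 𝒪_X` is torsion free
(generic points of `X` lie over `ξ`, `X` reduced), `(f_* 𝒪_X)_ξ = H⁰(X_ξ, 𝒪) = κ(ξ)`, and
`f_* 𝒪_X` is integral over `𝒪_S` (`f` universally closed) with `𝒪_S` normal, so
`f_* 𝒪_X = 𝒪_S`. Here: with `A = 𝒪_S(U)`, `B = 𝒪_X(f⁻¹U)`, the restriction
`ρ : B → Γ(X_ξ, 𝒪)` is injective (`injective_appLE_fiberι_top`), the square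
`A → B → Γ(X_ξ, 𝒪)` = `A → Γ(Spec κ(ξ), 𝒪) ≅ Γ(X_ξ, 𝒪)` commutes, `Γ(Spec κ(ξ), 𝒪) = Frac A`
(`isFractionRing_sections_residueField_genericPoint`), `A → B` is integral
(`isIntegral_app_of_universallyClosed`) and `A` is integrally closed
(`isIntegrallyClosed_sections_of_stalk`); so every `b ∈ B` restricts to an element of `Frac A`
integral over `A`, i.e. to some `a ∈ A`, and `b = a` by injectivity of `ρ`.
[cite: StacksProject, Tag 0AY8 (More on Morphisms, Lemma 37.53.6)] -/
theorem bijective_app (U : S.Opens) (hU : IsAffineOpen U) [Nonempty U] :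
    Function.Bijective (f.app U) := by
  have hξU : genericPoint S ∈ U := genericPoint_mem S U
  have hle₁ := top_le_preimage_fromSpecResidueField S U
  have hle₂ : (⊤ : (f.fiber (genericPoint S)).Opens) ≤
      (f.fiberι (genericPoint S)) ⁻¹ᵁ (f ⁻¹ᵁ U) := by
    rintro x -
    show f.base ((f.fiberι (genericPoint S)).base x) ∈ U
    have hx : (f.fiberι (genericPoint S)).base x ∈ f.base ⁻¹' {genericPoint S} := by
      rw [← Scheme.Hom.range_fiberι]; exact ⟨x, rfl⟩
    rw [Set.mem_preimage, Set.mem_singleton_iff] at hx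
    rw [hx]; exact hξU
  -- the four ring maps
  set φ : Γ(S, U) →+* Γ(X, f ⁻¹ᵁ U) := (f.app U).hom with hφ
  set ρ : Γ(X, f ⁻¹ᵁ U) →+* Γ(f.fiber (genericPoint S), ⊤) :=
    ((f.fiberι (genericPoint S)).appLE (f ⁻¹ᵁ U) ⊤ hle₂).hom with hρ
  set ι : Γ(S, U) →+* Γ(Spec (S.residueField (genericPoint S)), ⊤) :=
    ((S.fromSpecResidueField (genericPoint S)).appLE U ⊤ hle₁).hom with hι
  set γ : Γ(Spec (S.residueField (genericPoint S)), ⊤) →+* Γ(f.fiber (genericPoint S), ⊤) :=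
    (f.fiberToSpecResidueField (genericPoint S)).appTop.hom with hγ
  -- the square of sections of the fibre square commutes
  have hsq : ρ.comp φ = γ.comp ι := by
    -- stated over the open `X_ξ ×_{Spec κ(ξ)} ⊤ = ⊤` of `X_ξ`, the target of `app ⊤`
    have E : f.app U ≫ (f.fiberι (genericPoint S)).appLE (f ⁻¹ᵁ U)
        ((f.fiberToSpecResidueField (genericPoint S)) ⁻¹ᵁ ⊤) hle₂ =
        (S.fromSpecResidueField (genericPoint S)).appLE U ⊤ hle₁ ≫
          (f.fiberToSpecResidueField (genericPoint S)).app ⊤ := by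
      rw [Scheme.Hom.app_eq_appLE f, Scheme.Hom.appLE_comp_appLE,
        Scheme.Hom.appLE.congr_simp _ _ (f.fiber_fac _),
        Scheme.Hom.app_eq_appLE (f.fiberToSpecResidueField (genericPoint S)),
        Scheme.Hom.appLE_comp_appLE]
    exact congrArg CommRingCat.Hom.hom E
  have hsq' : ∀ a, ρ (φ a) = γ (ι a) := fun a ↦ congr($hsq a)
  -- `γ` is bijective (hypothesis (6)), `ρ` is injective
  have hγb : Function.Bijective γ := ConcreteCategory.bijective_of_isIso _
  have hρi : Function.Injective ρ := injective_appLE_fiberι_top f hX (f ⁻¹ᵁ U) hle₂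
  -- `A = 𝒪_S(U)` is an integrally closed domain with fraction field `Γ(Spec κ(ξ), 𝒪)`
  letI := ι.toAlgebra
  haveI : IsFractionRing Γ(S, U) Γ(Spec (S.residueField (genericPoint S)), ⊤) :=
    isFractionRing_sections_residueField_genericPoint S U hU
  haveI : IsIntegrallyClosed Γ(S, U) := isIntegrallyClosed_sections_of_stalk hU hS
  -- `A → B` is integral
  have hφint : φ.IsIntegral := isIntegral_app_of_universallyClosed f U hU
  refine ⟨?_, fun b ↦ ?_⟩
  · have hi : Function.Injective (ρ.comp φ) := by
      rw [hsq]
      exact hγb.1.comp (IsFractionRing.injective Γ(S, U) Γ(Spec (S.residueField (genericPoint S)), ⊤))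
    rw [RingHom.coe_comp] at hi
    exact hi.of_comp
  · have h1 : (γ.comp ι).IsIntegralElem (ρ b) := hsq ▸ (hφint b).map ρ
    obtain ⟨c, hc⟩ := hγb.2 (ρ b)
    have h2 : ι.IsIntegralElem c := RingHom.IsIntegralElem.of_map hγb.1 (hc ▸ h1)
    obtain ⟨a, ha⟩ := IsIntegrallyClosed.algebraMap_eq_of_integral (R := Γ(S, U)) h2
    refine ⟨a, hρi ?_⟩
    rw [hsq', ← hc, ← ha]
    rfl

/-- **Tag 0AY8, `f_* 𝒪_X = 𝒪_S`.** Under the hypotheses of Stacks Project, Tag 0AY8 (with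
"proper" weakened to "universally closed"), `𝒪_S(U) → 𝒪_X(f⁻¹U)` is an isomorphism for every
open `U ⊆ S`, i.e. `𝒪_S → f_* 𝒪_X` is an isomorphism (from the affine case `bijective_app`, the
affine opens forming a basis). [cite: StacksProject, Tag 0AY8 (More on Morphisms, Lemma 37.53.6)] -/
theorem isIso_app (U : S.Opens) : IsIso (f.app U) := by
  refine isIso_app_of_isIso_app_of_isAffineOpen f (fun U hU ↦ ?_) U
  by_cases hne : Nonempty U
  · exact (ConcreteCategory.isIso_iff_bijective _).mpr (bijective_app f hS hX hξ U hU)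
  · refine isIso_app_of_eq_bot f ?_
    rw [← Opens.coe_eq_empty, ← Set.not_nonempty_iff_eq_empty]
    exact fun ⟨x, hx⟩ ↦ hne ⟨⟨x, hx⟩⟩

/-- **Tag 0AY8, `S' = S`.** Under the hypotheses of Stacks Project, Tag 0AY8 (with "proper"
weakened to "universally closed"), the integral part `π : S' → S` of the Stein factorisation —
Mathlib's `f.fromNormalization`, `S'` the normalisation of `S` in `X` (Tag 035H) — is an
isomorphism: over an affine open `U`, `S'` is `Spec` of the integral closure of `𝒪_S(U)` in
`𝒪_X(f⁻¹U) = 𝒪_S(U)` (`bijective_app`). This is the step "it is enough to show that `S' = S`"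
of the printed proof. [cite: StacksProject, Tag 0AY8 (More on Morphisms, Lemma 37.53.6, proof)] -/
theorem isIso_fromNormalization [QuasiSeparated f] : IsIso f.fromNormalization := by
  apply IsZariskiLocalAtTarget.of_forall_exists_morphismRestrict
    (P := MorphismProperty.isomorphisms Scheme)
  intro x
  obtain ⟨_, ⟨U, hU, rfl⟩, hxU, -⟩ :=
    S.isBasis_affineOpens.exists_subset_of_mem_open (Set.mem_univ x) isOpen_univ
  refine ⟨U, hxU, ?_⟩
  show IsIso (f.fromNormalization ∣_ U)
  haveI : Nonempty U := ⟨⟨x, hxU⟩⟩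
  rw [isIso_morphismRestrict_iff_isIso_app _ hU, f.fromNormalization_app hU]
  letI := (f.app U).hom.toAlgebra
  have hb := bijective_app f hS hX hξ U hU
  have hbij : Function.Bijective
      (algebraMap Γ(S, U) (integralClosure Γ(S, U) Γ(X, f ⁻¹ᵁ U))) := by
    refine ⟨fun a b e ↦ hb.1 (congrArg Subtype.val e), fun b ↦ ?_⟩
    obtain ⟨a, ha⟩ := hb.2 b.1
    exact ⟨a, Subtype.ext ha⟩
  haveI : IsIso (CommRingCat.ofHom
      (algebraMap Γ(S, U) (integralClosure Γ(S, U) Γ(X, f ⁻¹ᵁ U)))) :=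
    (ConcreteCategory.isIso_iff_bijective _).mpr hbij
  infer_instance

end Main

end TowardsNormal


/-- **Stacks Project, Tag 0AY8 from Tag 03H2.** The printed proof of Tag 0AY8 (More on Morphisms,
Lemma 37.53.6): apply Stein factorisation `X → S' → S` (Tag 03H2 = Theorem 37.53.5) and show
`S' = S` (`TowardsNormal.isIso_fromNormalization`), whence `f = f'` has geometrically connected
fibres by Tag 03H2 (1) (the named fact `steinFactorization_geometricallyConnected`, through its
corollary `steinFactorization_geometricallyConnected.of_isIso_fromNormalization`); and
`f_* 𝒪_X = 𝒪_S` (`TowardsNormal.isIso_app`, unconditional). So the named fact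
`geometricallyConnected_towards_normal` (Tag 0AY8 as printed) follows from the named fact
`steinFactorization_geometricallyConnected` (Tag 03H2 (1)), exactly as in the source; what it
adds to Tag 03H2 is proved here unconditionally.
[cite: StacksProject, Tag 0AY8 (More on Morphisms, Lemma 37.53.6)] -/
theorem geometricallyConnected_towards_normal_of_steinFactorization
    (h : steinFactorization_geometricallyConnected.{u}) :
    geometricallyConnected_towards_normal.{u} := by
  intro X S f _ _ hS _ hX hξ
  refine ⟨fun U ↦ TowardsNormal.isIso_app f hS hX hξ U, ?_⟩
  haveI := TowardsNormal.isIso_fromNormalization f hS hX hξ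
  exact h.of_isIso_fromNormalization f

/-- **Tag 0AY8, first conclusion, unconditionally**: under the hypotheses of the named fact
`geometricallyConnected_towards_normal` (Stacks Project, Tag 0AY8), `𝒪_S → f_* 𝒪_X` is an
isomorphism. [cite: StacksProject, Tag 0AY8 (More on Morphisms, Lemma 37.53.6)] -/
theorem geometricallyConnected_towards_normal_isIso_app {X S : Scheme.{u}} (f : X ⟶ S)
    [IsProper f] [IsIntegral S] (hS : ∀ s : S, IsIntegrallyClosed (S.presheaf.stalk s))
    [IsReduced X] (hX : ∀ x ∈ genericPoints X, f.base x = genericPoint S)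
    (hξ : IsIso (f.fiberToSpecResidueField (genericPoint S)).appTop) (U : S.Opens) :
    IsIso (f.app U) :=
  TowardsNormal.isIso_app f hS hX hξ U

/-- **Tag 0AY8, reduced to Zariski's connectedness theorem for this one morphism**: under the
hypotheses of `geometricallyConnected_towards_normal`, `S' → S` is an isomorphism, so the only
missing input for `GeometricallyConnected f` is `GeometricallyConnected f.toNormalization`
(Tag 03H2 (1) for this `f`). [cite: StacksProject, Tag 0AY8 (More on Morphisms, Lemma 37.53.6, proof)] -/
theorem geometricallyConnected_towards_normal_of_toNormalization {X S : Scheme.{u}} (f : X ⟶ S)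
    [IsProper f] [IsIntegral S] (hS : ∀ s : S, IsIntegrallyClosed (S.presheaf.stalk s))
    [IsReduced X] (hX : ∀ x ∈ genericPoints X, f.base x = genericPoint S)
    (hξ : IsIso (f.fiberToSpecResidueField (genericPoint S)).appTop)
    (hf : GeometricallyConnected f.toNormalization) :
    (∀ U : S.Opens, IsIso (f.app U)) ∧ GeometricallyConnected f := by
  refine ⟨fun U ↦ TowardsNormal.isIso_app f hS hX hξ U, ?_⟩
  haveI := TowardsNormal.isIso_fromNormalization f hS hX hξ
  have hf' : GeometricallyConnected (f.toNormalization ≫ f.fromNormalization) :=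
    MorphismProperty.RespectsIso.postcomp (P := @GeometricallyConnected) _ _ hf
  rwa [Scheme.Hom.toNormalization_fromNormalization] at hf'

end Literature.AlgebraicGeometry.Morphisms

end
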